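import Summits.QuantumFields.YangMills.Theorems.BalabanUVNodesN15PerCubeGreenSopInverse
import Summits.QuantumFields.YangMills.Theorems.BalabanUVNodesN15PerCubeGreenAll
import HarnessLib

/-!
# N15 = NE2, road (c) — PROGRAMME (PC), (PC-C): THE COVARIANT LANDAU TERM `D_U(I − R(U))D*_U` DECAYS FOR `U` IN THE PER-CUBE CLASS — entries 2 and 3 of (3.42) per cube (n15-c∕288)
# around the coarse kernel `Q′ᵀ(Q′G′²Q′ᵀ)⁻¹Q′` (n15-c∕299e), composed at their scales on the bond carrier (dag-n15-c g28, n15-c∕299h)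

Cell `pub-ymgap`, seat `pub-ymgap-dag-n15-c` (generation g28; R134 (a), s1; HUMAN RULING D-0062).  `bears_on: R4∕N15 · K3⁸ SpineGivenEndpointR13SepCoPHV (stmt-QuantumFields-27366)`;
filed `--kind proof --supports stmt-QuantumFields-27366 --as helper` — COUNT-NEUTRAL.  0 `def`, 0 `sorry`.  Imports n15-c∕299e `…PerCubeGreenSopInverse` (★★★★ `hasMaj_cSop_inv_of_reg335BigBox`),
n15-c∕288 `…PerCubeGreenAll` (★★★★ `hasMaj_cGreen_all_of_reg335Box2`: entries 0, 2, 3 of (3.42) for the named `G′(U)` per cube), n15-c∕202∕205, FILE 119.  Nothing in the tree is modified.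

WHY ([B9] (3.26) p.395: the covariant Landau summand `D_UR(U)D*_U = D_UD*_U − D_U(I − R(U))D*_U`; (3.25): `I − R = G′Q′*(Q′G′²Q′*)⁻¹Q′G′`).  The (P-R) programme's Landau letter
`N_V^R = D_U(I − R(U))D*_U − flat` (n15-c∕197 `landauCov`) is, for `U` in the PRINTED per-cube class, the product `(D_UG′)·(Q′ᵀ(Q′G′²Q′ᵀ)⁻¹Q′)·(G′D*_U)` of entry 2 of (3.42) (site → bond,
n15-c∕278∕288), the coarse kernel (n15-c∕299e with the block averagings at their scales `(L^k)^{∓(d+1)}`) and entry 3 (bond → site, n15-c∕286∕288) — all with per-cube rows now: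
★ `hasMaj_bond_of_pull` (a bond-carrier majorant from the `d + 1` pulled components), `bigBox_fits₂` ∕ `reg335Cube_box2plus_of_bigBox` (the two-collar boxes `c(2w+2,□) + [0,6w+5)` of 288 sit
in the walk-locality box), ★★★★ `hasMaj_landauCov_of_reg335BigBox`: `mulVecLin (landauCov (cvT e U) a_K) ≤ B·e^{−δ|y−y′|_T}` on the coloured bond carrier, uniformly in `k`, under 299e's
hypotheses plus 288's third letter bound.

HONEST FRAMING ∕ LIMITS.  MODEL carriers (n15-c∕262's cover, `L ≥ 11`, class asked on the walk-locality boxes); the SHAPE of (3.25)–(3.26) ∕ (3.42), NOT the printed theorems; no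
operator of record estimated; the flat counterpart and the two-grid η-defect of `N_V^R` in the per-cube class are NOT here.  NE2⁺ NOT PRINTED, NOT proved; N15 of record untouched;
K3⁸ OPEN; counts UNMOVED.  Restate-immune (no Theses import).
-/

noncomputable section

open scoped BigOperators Matrix Matrix.Norms.L2Operator

namespace Summit.QuantumFields.YangMills.BalabanUVNodes.N15.Gluing

open Real
open Literature.MathematicalPhysics.QuantumFieldTheory.Balaban1983to89
open Literature.MathematicalPhysics.QuantumFieldTheory.Balaban1983to89.B5Prop11Plancherel (Tor fine unitVec)
open Literature.MathematicalPhysics.QuantumFieldTheory.Balaban1983to89.B11SectG (BlockNorm HasMaj RowSum)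
open Literature.MathematicalPhysics.QuantumFieldTheory.Balaban1983to89.B6RandomWalk (Triangle254)
open Literature.MathematicalPhysics.QuantumFieldTheory.Balaban1983to89.B6UnitTorusCarrier (unitTorusGeo triangle254_unitTorusGeo rowSum_unitTorusGeo unitTorusGeo_dist_nonneg unitTorusGeo_dist_self)
open Literature.MathematicalPhysics.QuantumFieldTheory.Balaban1983to89.B9Eq335RegularityClasses (Reg335Cube)
open Literature.MathematicalPhysics.QuantumFieldTheory.Balaban1983to89.B9Eq3117Current (gaugeTr)
open Literature.MathematicalPhysics.QuantumFieldTheory.Balaban1983to89.B9Eq39Adjoint (fluct)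
open Literature.MathematicalPhysics.QuantumFieldTheory.Balaban1983to89.T4EtaRateCoeffDefect (pull pull_apply)
open Literature.MathematicalPhysics.QuantumFieldTheory.Balaban1983to89.B11AxialTransport190 (abs_le_loc_ofBlocks loc_ofBlocks_le)
open Summit.QuantumFields.YangMills.BalabanUVNodes.N15.CovLandau (cSop cGreen csavg cgrad cPi landauCov hasMaj_csavg hasMaj_csavg_transpose)
open Summit.QuantumFields.YangMills.BalabanUVNodes.N15.BackgroundModel (kappa_ofBlocks)
open Literature.MathematicalPhysics.QuantumFieldTheory.King1986 (aK)
open Literature.MathematicalPhysics.QuantumFieldTheory.King1986.Torus (blockOf)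
open Literature.Barriers.QuantumFields (traceForm)
open Summit.QuantumFields.YangMills.BalabanUVNodes.N15.MatrixSpecies (basisConst liftBlk)
open Summit.QuantumFields.YangMills.BalabanUVNodes.N15.TwoGrid (cubeBlocks hasMaj_smul_ofBlocks)
open Summit.QuantumFields.YangMills.BalabanUVNodes.N15.CurvedSpecies (uN_val_inv_eq_conjTranspose)

variable {d : ℕ}

/-! ## §1 A bond-carrier majorant from the pulled components -/

section Bond

variable {X κ J : Type} [Fintype X] [Fintype κ] [Fintype J] {g : B6.Geometry} {F : Type} [AddCommGroup F] [Module ℝ F]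

/-- ★ a majorant into the coloured BOND carrier `(X × J) × κ` (blocks read on the base point) from the same majorant for every pulled component `f ↦ (T f)((·, μ), ·)`. [folklore] -/
theorem hasMaj_bond_of_pull (blk : X → g.Site) {b₁ : BlockNorm g F} {T : F →ₗ[ℝ] ((X × J) × κ → ℝ)} {K : g.Site → g.Site → ℝ} (hK : ∀ y y', 0 ≤ K y y')
    (h : ∀ μ : J, HasMaj b₁ (BlockNorm.ofBlocks g (liftBlk blk κ)) (pull (fun p : X × κ => ((p.1, μ), p.2)) ∘ₗ T) K) :
    HasMaj b₁ (BlockNorm.ofBlocks g (liftBlk (fun b : X × J => blk b.1) κ)) T K := by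
  intro y' f hf y
  refine loc_ofBlocks_le (liftBlk (fun b : X × J => blk b.1) κ) _ (mul_nonneg (hK y y') (b₁.loc_nonneg y' f)) fun q hq => ?_
  have hx : liftBlk blk κ (q.1.1, q.2) = y := hq
  have h1 := abs_le_loc_ofBlocks (liftBlk blk κ) ((pull (fun p : X × κ => ((p.1, q.1.2), p.2)) ∘ₗ T) f) hx
  rw [LinearMap.comp_apply, pull_apply] at h1
  exact h1.trans (h q.1.2 y' f hf y)

end Bond

/-! ## §2 The two-collar boxes of n15-c∕288 inside the walk-locality box -/

section Boxes

variable {L : ℕ} [NeZero L]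

omit [NeZero L] in
/-- the walk-locality box holds the box `c(2w+2,□) + [0, 6w+5)` and fits in the torus (`L ≥ 11`). [folklore] -/
theorem bigBox_fits₂ (hL11 : 11 ≤ L) (mv : ℕ) :
    2 * L ^ mv + 2 ≤ L * L ^ mv + 3 * L ^ mv - 1 - coverMargin L mv ∧
      (L * L ^ mv + 3 * L ^ mv - 1 - coverMargin L mv - (2 * L ^ mv + 2)) + (6 * L ^ mv + 5) ≤ L * L ^ mv + 10 * L ^ mv ∧
      L * L ^ mv + 10 * L ^ mv ≤ 2 * L * L ^ mv := by
  have hw1 : 1 ≤ L ^ mv := Nat.one_le_pow _ _ (by omega)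
  have hLw : 11 * L ^ mv ≤ L * L ^ mv := Nat.mul_le_mul_right _ hL11
  have e2 : 2 * L * L ^ mv = 2 * (L * L ^ mv) := by ring
  have hm : 2 * coverMargin L mv + 2 * L ^ mv ≤ L * L ^ mv := by
    unfold coverMargin
    have hLm : (L - 2) * L ^ mv = L * L ^ mv - 2 * L ^ mv := Nat.sub_mul L 2 (L ^ mv)
    omega
  generalize coverMargin L mv = m0 at hm ⊢
  generalize L * L ^ mv = Q at hLw e2 hm ⊢
  generalize L ^ mv = w at hw1 hLw hm e2 ⊢
  omega

/-- the walk-locality-box data give r06's class on the boxes `c(2w+2,□) + [0,6w+5)` of n15-c∕288 (entries 2 and 3 of (3.42)). [cite: Balaban1985BackgroundPropagators, (3.35) p.396 (shape)] -/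
theorem reg335Cube_box2plus_of_bigBox (hL : Odd L ∧ 1 < L) (hL11 : 11 ≤ L) (mv kk : ℕ) {mm : Type} [Fintype mm] [DecidableEq mm] [Nonempty mm]
    (U : Fin (d + 1) → ScX d L mv kk hL → (Matrix mm mm ℂ)ˣ) {ξ C : ℝ} (k : Fin (d + 1) → ZMod (2 * L))
    (h : ∃ (u : ScX d L mv kk hL → (Matrix mm mm ℂ)ˣ) (A : Fin (d + 1) → ScX d L mv kk hL → Matrix mm mm ℂ),
          (∀ x, (u x : Matrix mm mm ℂ) ∈ Matrix.unitaryGroup mm ℂ) ∧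
          (∀ μ, ∀ z ∈ {x : ScX d L mv kk hL | blockOf (L ^ kk) (cvM d L mv kk hL) x ∈ cubeBlocks (cvM d L mv kk hL) (coverCorner (cvM d L mv kk hL) (L ^ mv) L (L * L ^ mv + 3 * L ^ mv - 1 - coverMargin L mv) k) (L * L ^ mv + 10 * L ^ mv)},
              gaugeTr (scShift d L mv kk hL) u U μ z = fluct ((((L ^ kk : ℕ) : ℝ))⁻¹) A μ z) ∧
          (∀ μ, ∀ z ∈ {x : ScX d L mv kk hL | blockOf (L ^ kk) (cvM d L mv kk hL) x ∈ cubeBlocks (cvM d L mv kk hL) (coverCorner (cvM d L mv kk hL) (L ^ mv) L (L * L ^ mv + 3 * L ^ mv - 1 - coverMargin L mv) k) (L * L ^ mv + 10 * L ^ mv)},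
              ‖A μ z‖ < C * ξ⁻¹) ∧
          (∀ μ ν, ∀ z ∈ {x : ScX d L mv kk hL | blockOf (L ^ kk) (cvM d L mv kk hL) x ∈ cubeBlocks (cvM d L mv kk hL) (coverCorner (cvM d L mv kk hL) (L ^ mv) L (L * L ^ mv + 3 * L ^ mv - 1 - coverMargin L mv) k) (L * L ^ mv + 10 * L ^ mv)},
              ‖((↑((((L ^ kk : ℕ) : ℝ))⁻¹) : ℂ)⁻¹) • B9Eq39Adjoint.covD (scShift d L mv kk hL) (fun _ _ => (1 : (Matrix mm mm ℂ)ˣ)) μ (A ν) z‖ < C * (ξ ^ 2)⁻¹)) :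
    Reg335Cube (scShift d L mv kk hL) U ((((L ^ kk : ℕ) : ℝ))⁻¹) {x : ScX d L mv kk hL | blockOf (L ^ kk) (cvM d L mv kk hL) x ∈ cubeBlocks (cvM d L mv kk hL) (coverCorner (cvM d L mv kk hL) (L ^ mv) L (2 * L ^ mv + 2) k) (6 * L ^ mv + 5)} ξ C := by
  obtain ⟨u, A, hu, hg, hA, hD⟩ := h
  have hM : ∀ ν, cvM d L mv kk hL ν = 2 * L * L ^ mv := MP_succ_eq L mv kk hL
  obtain ⟨h1, h2, h3⟩ := bigBox_fits₂ hL11 mv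
  have hsub : ∀ x : ScX d L mv kk hL, blockOf (L ^ kk) (cvM d L mv kk hL) x ∈ cubeBlocks (cvM d L mv kk hL) (coverCorner (cvM d L mv kk hL) (L ^ mv) L (2 * L ^ mv + 2) k) (6 * L ^ mv + 5) →
      blockOf (L ^ kk) (cvM d L mv kk hL) x ∈ cubeBlocks (cvM d L mv kk hL) (coverCorner (cvM d L mv kk hL) (L ^ mv) L (L * L ^ mv + 3 * L ^ mv - 1 - coverMargin L mv) k) (L * L ^ mv + 10 * L ^ mv) :=
    fun x hx => mem_cubeBlocks_of_mem_inner hM (by omega) h2 h3 hx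
  have hu1 : ∀ x, ‖(u x : Matrix mm mm ℂ)‖ ≤ 1 ∧ ‖(((u x)⁻¹ : (Matrix mm mm ℂ)ˣ) : Matrix mm mm ℂ)‖ ≤ 1 := fun x =>
    ⟨(CStarRing.norm_of_mem_unitary (hu x)).le, by
      rw [uN_val_inv_eq_conjTranspose (hu x)]
      exact (CStarRing.norm_of_mem_unitary (Unitary.star_mem (hu x))).le⟩
  exact ⟨u, A, fun z _ => hu1 z, fun κ z hz => hg κ z (hsub z hz), fun κ z hz => hA κ z (hsub z hz), fun κ ν z hz => hD κ ν z (hsub z hz)⟩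

end Boxes

/-! ## §3 The covariant Landau term per cube -/

section Landau

variable {L : ℕ} [NeZero L]

set_option maxHeartbeats 400000 in
/-- ★★★★ **THE COVARIANT LANDAU TERM `D_U(I − R(U))D*_U` DECAYS FOR `U` IN THE PER-CUBE CLASS, UNIFORMLY IN `k`**: under n15-c∕299e's hypotheses (a unitary gauge + (3.35) potential on the
walk-locality box of every cube, letters `r_V`, `σ(r_V) ≤ R₀`, `L^m ≥ w₀`) and n15-c∕288's third letter bound: `mulVecLin (landauCov (cvT e U) a_K) ≤ B·e^{−δ|y−y′|_T}` on the coloured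
bond carrier — `(D_UG′)·((L^k)^{d+1}Q′ᵀ)·((L^k)^{−(d+1)}(Q′G′²Q′ᵀ)⁻¹)·Q′·(G′D*_U)` with entry 2 (n15-c∕288, assembled on bonds by §1), the coarse kernel (n15-c∕299e, n15-c∕202∕205) and entry 3
(n15-c∕288).  MODEL carriers; the SHAPE of [B9] (3.25)–(3.26) ∕ (3.42), NOT the printed theorems. [cite: Balaban1985BackgroundPropagators, (3.25)–(3.26) pp.394–395, Thm 3.1 (3.42) p.397, Thm 3.2 (3.48) p.398, (3.95)–(3.96) p.411 (shapes ∕ mechanism); Balaban1984PropagatorsI, (1.69) p.29] -/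
theorem hasMaj_landauCov_of_reg335BigBox (hL : Odd L ∧ 1 < L) (hL11 : 11 ≤ L) {a₀ : ℝ} (ha₀ : 0 < a₀) (ι : Type) [Fintype ι] [DecidableEq ι] :
    ∃ δ w₀ R₀ B : ℝ, 0 < δ ∧ 0 < R₀ ∧ 0 < B ∧
      ∀ (mv kk : ℕ), 1 ≤ kk → w₀ ≤ ((L ^ mv : ℕ) : ℝ) →
      ∀ {mm : Type} [Fintype mm] [DecidableEq mm] [Nonempty mm] (e : Matrix mm mm ℂ ≃L[ℝ] (ι → ℝ)), (∀ A B : Matrix mm mm ℂ, traceForm A B = e A ⬝ᵥ e B) →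
      ∀ (U : Fin (d + 1) → ScX d L mv kk hL → (Matrix mm mm ℂ)ˣ), (∀ μ x, (U μ x : Matrix mm mm ℂ) ∈ Matrix.unitaryGroup mm ℂ) →
      ∀ (ξ C : ℝ), 0 < ξ → 0 < C →
        (∀ k : Fin (d + 1) → ZMod (2 * L), ∃ (u : ScX d L mv kk hL → (Matrix mm mm ℂ)ˣ) (A : Fin (d + 1) → ScX d L mv kk hL → Matrix mm mm ℂ),
          (∀ x, (u x : Matrix mm mm ℂ) ∈ Matrix.unitaryGroup mm ℂ) ∧
          (∀ μ, ∀ z ∈ {x : ScX d L mv kk hL | blockOf (L ^ kk) (cvM d L mv kk hL) x ∈ cubeBlocks (cvM d L mv kk hL) (coverCorner (cvM d L mv kk hL) (L ^ mv) L (L * L ^ mv + 3 * L ^ mv - 1 - coverMargin L mv) k) (L * L ^ mv + 10 * L ^ mv)},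
              gaugeTr (scShift d L mv kk hL) u U μ z = fluct ((((L ^ kk : ℕ) : ℝ))⁻¹) A μ z) ∧
          (∀ μ, ∀ z ∈ {x : ScX d L mv kk hL | blockOf (L ^ kk) (cvM d L mv kk hL) x ∈ cubeBlocks (cvM d L mv kk hL) (coverCorner (cvM d L mv kk hL) (L ^ mv) L (L * L ^ mv + 3 * L ^ mv - 1 - coverMargin L mv) k) (L * L ^ mv + 10 * L ^ mv)},
              ‖A μ z‖ < C * ξ⁻¹) ∧
          (∀ μ ν, ∀ z ∈ {x : ScX d L mv kk hL | blockOf (L ^ kk) (cvM d L mv kk hL) x ∈ cubeBlocks (cvM d L mv kk hL) (coverCorner (cvM d L mv kk hL) (L ^ mv) L (L * L ^ mv + 3 * L ^ mv - 1 - coverMargin L mv) k) (L * L ^ mv + 10 * L ^ mv)},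
              ‖((↑((((L ^ kk : ℕ) : ℝ))⁻¹) : ℂ)⁻¹) • B9Eq39Adjoint.covD (scShift d L mv kk hL) (fun _ _ => (1 : (Matrix mm mm ℂ)ˣ)) μ (A ν) z‖ < C * (ξ ^ 2)⁻¹)) →
      ∀ (rV : ℝ), 0 ≤ rV →
        Fintype.card ι * (@basisConst ι _ (Matrix mm mm ℂ) Matrix.frobeniusNormedAddCommGroup Matrix.frobeniusNormedSpace e * (2 * Real.sqrt (Fintype.card mm)) * (Real.sqrt (Fintype.card mm) * ((C / ξ) * Real.exp (((((L ^ kk : ℕ) : ℝ))⁻¹) * (C / ξ))))) ≤ rV →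
        Fintype.card ι * (Fintype.card (Fin (d + 1)) * (Fintype.card ι * (@basisConst ι _ (Matrix mm mm ℂ) Matrix.frobeniusNormedAddCommGroup Matrix.frobeniusNormedSpace e * (2 * Real.sqrt (Fintype.card mm)) * (Real.sqrt (Fintype.card mm) * ((C / ξ) * Real.exp (((((L ^ kk : ℕ) : ℝ))⁻¹) * (C / ξ))))) ^ 2 + @basisConst ι _ (Matrix mm mm ℂ) Matrix.frobeniusNormedAddCommGroup Matrix.frobeniusNormedSpace e * (2 * Real.sqrt (Fintype.card mm)) * (Real.sqrt (Fintype.card mm) * ((C / ξ ^ 2) * Real.exp (((((L ^ kk : ℕ) : ℝ))⁻¹) * (C / ξ)))))) ≤ rV →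
        Fintype.card ι * (@basisConst ι _ (Matrix mm mm ℂ) Matrix.frobeniusNormedAddCommGroup Matrix.frobeniusNormedSpace e * (2 * Real.sqrt (Fintype.card mm)) * (Real.sqrt (Fintype.card mm) * ((C / ξ ^ 2) * Real.exp (((((L ^ kk : ℕ) : ℝ))⁻¹) * (C / ξ))))) ≤ rV →
        rV * (1 + Fintype.card (Fin (d + 1) ⊕ Fin (d + 1))) + a₀ * (Fintype.card ι * (Fintype.card ι * ((1 + rV * ((((L ^ kk : ℕ) : ℝ))⁻¹)) ^ ((d + 1) * L ^ kk) - 1) ^ 2 + 2 * ((1 + rV * ((((L ^ kk : ℕ) : ℝ))⁻¹)) ^ ((d + 1) * L ^ kk) - 1))) ≤ R₀ →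
        ((1 + rV * ((((L ^ kk : ℕ) : ℝ))⁻¹)) ^ ((d + 1) * L ^ kk) - 1) ≤ R₀ →
        HasMaj (BlockNorm.ofBlocks (unitTorusGeo L kk (cvM d L mv kk hL)) (liftBlk (fun b : ScX d L mv kk hL × Fin (d + 1) => blockOf (L ^ kk) (cvM d L mv kk hL) b.1) ι))
            (BlockNorm.ofBlocks (unitTorusGeo L kk (cvM d L mv kk hL)) (liftBlk (fun b : ScX d L mv kk hL × Fin (d + 1) => blockOf (L ^ kk) (cvM d L mv kk hL) b.1) ι))
            (Matrix.mulVecLin (landauCov (cvM d L mv kk hL) (L ^ kk) (cvT e (fun μ x => (U μ x : Matrix mm mm ℂ))) (aK a₀ (L : ℝ) kk * (((L ^ kk : ℕ) : ℝ)) ^ (d + 1))))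
          (fun y y' => B * Real.exp (-(δ * (unitTorusGeo L kk (cvM d L mv kk hL)).dist y y'))) := by
  classical
  have hL7 : 7 ≤ L := by omega
  obtain ⟨δ₁, w₁, R₁, B₀, B₂, cJ, B₃, hδ₁, hR₁, hB₀, hB₂, hcJ, hB₃, HA⟩ := hasMaj_cGreen_all_of_reg335Box2 (d := d) hL hL7 ha₀ ι
  obtain ⟨δS, wS, RS, BS, hδS, hRS, hBS, HS⟩ := hasMaj_cSop_inv_of_reg335BigBox (d := d) hL hL11 ha₀ ι
  set δ₀ : ℝ := min (δ₁ / 16) δS with hδ₀def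
  have hδ₀ : 0 < δ₀ := lt_min (by positivity) hδS
  have hδ₀₁ : δ₀ ≤ δ₁ / 16 := min_le_left _ _
  have hδ₀S : δ₀ ≤ δS := min_le_right _ _
  set m : ℝ := δ₀ / 10 with hmdef
  have hm : 0 < m := by positivity
  set cr : ℝ := B4Sect5Proof.latticeConst (d + 1) m with hcrdef
  have hcr0 : 0 ≤ cr := B4Sect5Proof.latticeConst_nonneg (d + 1) hm.le
  set τ : ℝ := (Fintype.card ι : ℝ) + 1 with hτdef
  have hτ0 : 0 ≤ τ := by positivity
  -- the constant is linear in `(1 + r_V c_J)(1 + r_V)`; we bound `r_V ≤ R₀ ≤ 1` below through `hRle`? No: keep `r_V` in a displayed a-priori way — require nothing and use `R₀ ≤ 1`.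
  refine ⟨δ₀ - 8 * m, max w₁ wS, min (min R₁ RS) 1, 1 * ((1 * (1 + 1 * cJ) + π) * B₂) * (1 * τ * (1 * BS * (1 * τ * (((d : ℝ) + 1) * (B₃ * (1 + 1))) * cr) * cr) * cr) * cr + 1, by rw [hmdef]; linarith,
    lt_min (lt_min hR₁ hRS) one_pos, by positivity, fun mv kk hk hw₀ => ?_⟩
  intro mm _ _ _ e he U hU ξ C hξ hC hbig rV hrV hrA hrC hrQ hRle hσV
  have hw₁ : w₁ ≤ ((L ^ mv : ℕ) : ℝ) := (le_max_left _ _).trans hw₀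
  have hwS : wS ≤ ((L ^ mv : ℕ) : ℝ) := (le_max_right _ _).trans hw₀
  have hRle₁ := hRle.trans ((min_le_left _ _).trans (min_le_left R₁ RS))
  have hRleS := hRle.trans ((min_le_left _ _).trans (min_le_right R₁ RS))
  have hσVS := hσV.trans ((min_le_left _ _).trans (min_le_right R₁ RS))
  -- `r_V ≤ 1` from the smallness hypothesis (`1 + |J⊕J| ≥ 1`, the rest nonnegative)
  have hSIG0 : 0 ≤ ((1 + rV * ((((L ^ kk : ℕ) : ℝ))⁻¹)) ^ ((d + 1) * L ^ kk) - 1) := by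
    have := one_le_pow₀ (M₀ := ℝ) (a := 1 + rV * ((((L ^ kk : ℕ) : ℝ))⁻¹)) (le_add_of_nonneg_right (by positivity)) (n := (d + 1) * L ^ kk); linarith only [this]
  have hrV1 : rV ≤ 1 := by
    have h1 := hRle.trans (min_le_right _ _)
    have h2 : 0 ≤ a₀ * (Fintype.card ι * (Fintype.card ι * ((1 + rV * ((((L ^ kk : ℕ) : ℝ))⁻¹)) ^ ((d + 1) * L ^ kk) - 1) ^ 2 + 2 * ((1 + rV * ((((L ^ kk : ℕ) : ℝ))⁻¹)) ^ ((d + 1) * L ^ kk) - 1))) :=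
      mul_nonneg ha₀.le (mul_nonneg (Nat.cast_nonneg _) (add_nonneg (by positivity) (mul_nonneg zero_le_two hSIG0)))
    have h3 : rV ≤ rV * (1 + Fintype.card (Fin (d + 1) ⊕ Fin (d + 1))) := le_mul_of_one_le_right hrV (le_add_of_nonneg_right (Nat.cast_nonneg _))
    linarith
  have hU' : ∀ μ x, ((U μ x : Matrix mm mm ℂ))ᴴ * (U μ x : Matrix mm mm ℂ) = 1 := fun μ x => Matrix.mem_unitaryGroup_iff'.mp (hU μ x)
  have htri : Triangle254 (unitTorusGeo L kk (cvM d L mv kk hL)) := triangle254_unitTorusGeo L kk _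
  have hd : ∀ a b : Tor (cvM d L mv kk hL), 0 ≤ (unitTorusGeo L kk (cvM d L mv kk hL)).dist a b := unitTorusGeo_dist_nonneg L kk _
  have hd0 : ∀ y : Tor (cvM d L mv kk hL), (unitTorusGeo L kk (cvM d L mv kk hL)).dist y y = 0 := unitTorusGeo_dist_self L kk _
  have hrow : RowSum (unitTorusGeo L kk (cvM d L mv kk hL)) m cr := by rw [hcrdef]; exact rowSum_unitTorusGeo L kk _ hm
  have hnpos : (0 : ℝ) < ((L ^ kk : ℕ) : ℝ) ^ (d + 1) := by positivity
  have hκF : (ScNorm d L mv kk hL ι).κ = 1 := kappa_ofBlocks _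
  have hκC : (BlockNorm.ofBlocks (unitTorusGeo L kk (cvM d L mv kk hL)) (liftBlk (fun y : Tor (cvM d L mv kk hL) => y) ι)).κ = 1 := kappa_ofBlocks _
  have hrate : ∀ ⦃c ρ ρ' : ℝ⦄, 0 ≤ c → ρ' ≤ ρ → ∀ y y' : Tor (cvM d L mv kk hL), c * Real.exp (-(ρ * (unitTorusGeo L kk (cvM d L mv kk hL)).dist y y')) ≤ c * Real.exp (-(ρ' * (unitTorusGeo L kk (cvM d L mv kk hL)).dist y y')) :=
    fun c ρ ρ' hc hρ y y' => mul_le_mul_of_nonneg_left (Real.exp_le_exp.mpr (by nlinarith only [hd y y', hρ])) hc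
  -- entries 2 (assembled on bonds) and 3 of (3.42), per cube
  have h335 := fun k => reg335Cube_box2plus_of_bigBox (d := d) hL hL11 mv kk U (ξ := ξ) (C := C) k (hbig k)
  obtain ⟨-, h2, -, h3⟩ := HA mv kk hk hw₁ e he U hU ξ C hξ hC.le h335 rV hrV hrA hrC hrQ hRle₁
  have hL2 : HasMaj (ScNorm d L mv kk hL ι) (BlockNorm.ofBlocks (unitTorusGeo L kk (cvM d L mv kk hL)) (liftBlk (fun b : ScX d L mv kk hL × Fin (d + 1) => blockOf (L ^ kk) (cvM d L mv kk hL) b.1) ι))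
      (Matrix.mulVecLin ((cgrad (cvM d L mv kk hL) (L ^ kk) (cvT e (fun μ x => (U μ x : Matrix mm mm ℂ)))) * (cGreen (cvM d L mv kk hL) (L ^ kk) (cvT e (fun μ x => (U μ x : Matrix mm mm ℂ))) (aK a₀ (L : ℝ) kk * (((L ^ kk : ℕ) : ℝ)) ^ (d + 1)))))
      (fun y y' => ((1 * (1 + 1 * cJ) + π) * B₂) * Real.exp (-(δ₀ * (unitTorusGeo L kk (cvM d L mv kk hL)).dist y y'))) := by
    refine hasMaj_bond_of_pull (g := unitTorusGeo L kk (cvM d L mv kk hL)) (scBlk d L mv kk hL) (fun y y' => by positivity) fun μ => (h2 μ).mono fun y y' => ?_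
    have hc : (1 * (1 + rV * cJ) + π) * B₂ ≤ (1 * (1 + 1 * cJ) + π) * B₂ := by
      have : rV * cJ ≤ 1 * cJ := mul_le_mul_of_nonneg_right hrV1 hcJ
      nlinarith [hB₂.le]
    calc (1 * (1 + rV * cJ) + π) * B₂ * Real.exp (-(δ₁ / 16 * (unitTorusGeo L kk (cvM d L mv kk hL)).dist y y')) ≤ (1 * (1 + 1 * cJ) + π) * B₂ * Real.exp (-(δ₁ / 16 * (unitTorusGeo L kk (cvM d L mv kk hL)).dist y y')) :=
        mul_le_mul_of_nonneg_right hc (Real.exp_nonneg _)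
      _ ≤ _ := hrate (c := (1 * (1 + 1 * cJ) + π) * B₂) (ρ := δ₁ / 16) (ρ' := δ₀) (by positivity) hδ₀₁ y y'
  have hR3 : HasMaj (BlockNorm.ofBlocks (unitTorusGeo L kk (cvM d L mv kk hL)) (liftBlk (fun b : ScX d L mv kk hL × Fin (d + 1) => blockOf (L ^ kk) (cvM d L mv kk hL) b.1) ι)) (ScNorm d L mv kk hL ι)
      (Matrix.mulVecLin ((cGreen (cvM d L mv kk hL) (L ^ kk) (cvT e (fun μ x => (U μ x : Matrix mm mm ℂ))) (aK a₀ (L : ℝ) kk * (((L ^ kk : ℕ) : ℝ)) ^ (d + 1))) * (cgrad (cvM d L mv kk hL) (L ^ kk) (cvT e (fun μ x => (U μ x : Matrix mm mm ℂ))))ᵀ))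
      (fun y y' => ((d : ℝ) + 1) * (B₃ * (1 + 1)) * Real.exp (-(δ₀ * (unitTorusGeo L kk (cvM d L mv kk hL)).dist y y'))) := by
    refine h3.mono fun y y' => ?_
    have hc : ((d : ℝ) + 1) * (B₃ * (1 + rV)) ≤ ((d : ℝ) + 1) * (B₃ * (1 + 1)) := by gcongr
    calc ((d : ℝ) + 1) * (B₃ * (1 + rV)) * Real.exp (-(δ₁ / 16 * (unitTorusGeo L kk (cvM d L mv kk hL)).dist y y')) ≤ ((d : ℝ) + 1) * (B₃ * (1 + 1)) * Real.exp (-(δ₁ / 16 * (unitTorusGeo L kk (cvM d L mv kk hL)).dist y y')) :=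
        mul_le_mul_of_nonneg_right hc (Real.exp_nonneg _)
      _ ≤ _ := hrate (c := ((d : ℝ) + 1) * (B₃ * (1 + 1))) (ρ := δ₁ / 16) (ρ' := δ₀) (by positivity) hδ₀₁ y y'
  -- the coarse kernel
  have hSi : HasMaj (BlockNorm.ofBlocks (unitTorusGeo L kk (cvM d L mv kk hL)) (liftBlk (fun y : Tor (cvM d L mv kk hL) => y) ι)) (BlockNorm.ofBlocks (unitTorusGeo L kk (cvM d L mv kk hL)) (liftBlk (fun y : Tor (cvM d L mv kk hL) => y) ι))
      ((((((L ^ kk : ℕ) : ℝ)) ^ (d + 1))⁻¹) • Matrix.mulVecLin (cSop (cvM d L mv kk hL) (L ^ kk) (cvT e (fun μ x => (U μ x : Matrix mm mm ℂ))) (aK a₀ (L : ℝ) kk * (((L ^ kk : ℕ) : ℝ)) ^ (d + 1)))⁻¹)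
      (fun y y' => BS * Real.exp (-(δ₀ * (unitTorusGeo L kk (cvM d L mv kk hL)).dist y y'))) := by
    have h := HS mv kk hk hwS e he U hU ξ C hξ hC hbig rV hrV hrA hrC hRleS hσVS
    have h1 := hasMaj_smul_ofBlocks (g := unitTorusGeo L kk (cvM d L mv kk hL)) (liftBlk (fun y : Tor (cvM d L mv kk hL) => y) ι)
      (K := fun y y' => BS * (((L ^ kk : ℕ) : ℝ)) ^ (d + 1) * Real.exp (-(δS * (unitTorusGeo L kk (cvM d L mv kk hL)).dist y y'))) (fun y y' => by positivity) (((((L ^ kk : ℕ) : ℝ)) ^ (d + 1))⁻¹) h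
    refine h1.mono fun y y' => ?_
    rw [abs_of_pos (inv_pos.2 hnpos), show ((((L ^ kk : ℕ) : ℝ)) ^ (d + 1))⁻¹ * (BS * (((L ^ kk : ℕ) : ℝ)) ^ (d + 1) * Real.exp (-(δS * (unitTorusGeo L kk (cvM d L mv kk hL)).dist y y'))) = BS * Real.exp (-(δS * (unitTorusGeo L kk (cvM d L mv kk hL)).dist y y')) by field_simp]
    exact hrate (c := BS) (ρ := δS) (ρ' := δ₀) hBS.le hδ₀S y y'
  have hQ : HasMaj (ScNorm d L mv kk hL ι) (BlockNorm.ofBlocks (unitTorusGeo L kk (cvM d L mv kk hL)) (liftBlk (fun y : Tor (cvM d L mv kk hL) => y) ι))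
      (Matrix.mulVecLin (csavg (cvM d L mv kk hL) (L ^ kk) (cvT e (fun μ x => (U μ x : Matrix mm mm ℂ))))) (fun y y' => τ * Real.exp (-(δ₀ * (unitTorusGeo L kk (cvM d L mv kk hL)).dist y y'))) := by
    have h := hasMaj_csavg (cvM d L mv kk hL) (L ^ kk) L kk (cvT e (fun μ x => (U μ x : Matrix mm mm ℂ))) (τ := τ) hτ0 fun y a i =>
      (rows_cvaStair_cvT_le (cvM d L mv kk hL) (L ^ kk) e he hU' y a 0 i).trans (by rw [hτdef]; linarith only [])
    exact HasMaj.diag_const_exp δ₀ hd0 hτ0 h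
  have hR : HasMaj (BlockNorm.ofBlocks (unitTorusGeo L kk (cvM d L mv kk hL)) (liftBlk (fun y : Tor (cvM d L mv kk hL) => y) ι)) (ScNorm d L mv kk hL ι)
      ((((L ^ kk : ℕ) : ℝ)) ^ (d + 1) • Matrix.mulVecLin (csavg (cvM d L mv kk hL) (L ^ kk) (cvT e (fun μ x => (U μ x : Matrix mm mm ℂ))))ᵀ) (fun y y' => τ * Real.exp (-(δ₀ * (unitTorusGeo L kk (cvM d L mv kk hL)).dist y y'))) := by
    have h := hasMaj_csavg_transpose (cvM d L mv kk hL) (L ^ kk) L kk (cvT e (fun μ x => (U μ x : Matrix mm mm ℂ))) (τ := Fintype.card ι) (Nat.cast_nonneg _)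
      fun y a i => cols_cvaStair_cvT_le (cvM d L mv kk hL) (L ^ kk) e he hU' y a 0 i
    have h1 := hasMaj_smul_ofBlocks (g := unitTorusGeo L kk (cvM d L mv kk hL)) (liftBlk (scBlk d L mv kk hL) ι) (K := fun w w' => if w = w' then ((((L ^ kk : ℕ) : ℝ)) ^ (d + 1))⁻¹ * (Fintype.card ι : ℝ) else 0)
      (fun w w' => by split_ifs <;> positivity) ((((L ^ kk : ℕ) : ℝ)) ^ (d + 1)) h
    have h2 : HasMaj (BlockNorm.ofBlocks (unitTorusGeo L kk (cvM d L mv kk hL)) (liftBlk (fun y : Tor (cvM d L mv kk hL) => y) ι)) (ScNorm d L mv kk hL ι)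
        ((((L ^ kk : ℕ) : ℝ)) ^ (d + 1) • Matrix.mulVecLin (csavg (cvM d L mv kk hL) (L ^ kk) (cvT e (fun μ x => (U μ x : Matrix mm mm ℂ))))ᵀ) (fun w w' => if w = w' then τ else 0) := h1.mono fun w w' => by
      split_ifs
      · rw [abs_of_pos hnpos, ← mul_assoc, mul_inv_cancel₀ hnpos.ne', one_mul, hτdef]; linarith only []
      · rw [mul_zero]
    exact HasMaj.diag_const_exp δ₀ hd0 hτ0 h2
  -- the product, innermost first
  set L2 := Matrix.mulVecLin ((cgrad (cvM d L mv kk hL) (L ^ kk) (cvT e (fun μ x => (U μ x : Matrix mm mm ℂ)))) * (cGreen (cvM d L mv kk hL) (L ^ kk) (cvT e (fun μ x => (U μ x : Matrix mm mm ℂ))) (aK a₀ (L : ℝ) kk * (((L ^ kk : ℕ) : ℝ)) ^ (d + 1)))) with hL2def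
  set R3 := Matrix.mulVecLin ((cGreen (cvM d L mv kk hL) (L ^ kk) (cvT e (fun μ x => (U μ x : Matrix mm mm ℂ))) (aK a₀ (L : ℝ) kk * (((L ^ kk : ℕ) : ℝ)) ^ (d + 1))) * (cgrad (cvM d L mv kk hL) (L ^ kk) (cvT e (fun μ x => (U μ x : Matrix mm mm ℂ))))ᵀ) with hR3def
  set Qop := Matrix.mulVecLin (csavg (cvM d L mv kk hL) (L ^ kk) (cvT e (fun μ x => (U μ x : Matrix mm mm ℂ)))) with hQop
  set Rop := ((((L ^ kk : ℕ) : ℝ)) ^ (d + 1) • Matrix.mulVecLin (csavg (cvM d L mv kk hL) (L ^ kk) (cvT e (fun μ x => (U μ x : Matrix mm mm ℂ))))ᵀ) with hRop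
  set Sop := ((((((L ^ kk : ℕ) : ℝ)) ^ (d + 1))⁻¹) • Matrix.mulVecLin (cSop (cvM d L mv kk hL) (L ^ kk) (cvT e (fun μ x => (U μ x : Matrix mm mm ℂ))) (aK a₀ (L : ℝ) kk * (((L ^ kk : ℕ) : ℝ)) ^ (d + 1)))⁻¹) with hSop
  have h1 : HasMaj (BlockNorm.ofBlocks (unitTorusGeo L kk (cvM d L mv kk hL)) (liftBlk (fun b : ScX d L mv kk hL × Fin (d + 1) => blockOf (L ^ kk) (cvM d L mv kk hL) b.1) ι))
      (BlockNorm.ofBlocks (unitTorusGeo L kk (cvM d L mv kk hL)) (liftBlk (fun y : Tor (cvM d L mv kk hL) => y) ι)) (Qop ∘ₗ R3)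
      (fun y y' => (ScNorm d L mv kk hL ι).κ * τ * (((d : ℝ) + 1) * (B₃ * (1 + 1))) * cr * Real.exp (-((δ₀ - 2 * m) * (unitTorusGeo L kk (cvM d L mv kk hL)).dist y y'))) :=
    B11SectG.hasMaj_comp_exp htri hd hrow hτ0 (by positivity) (by rw [hmdef]; linarith) (by rw [hmdef]; linarith) (by rw [hmdef]; linarith) hQ hR3
  have h2' : HasMaj (BlockNorm.ofBlocks (unitTorusGeo L kk (cvM d L mv kk hL)) (liftBlk (fun b : ScX d L mv kk hL × Fin (d + 1) => blockOf (L ^ kk) (cvM d L mv kk hL) b.1) ι))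
      (BlockNorm.ofBlocks (unitTorusGeo L kk (cvM d L mv kk hL)) (liftBlk (fun y : Tor (cvM d L mv kk hL) => y) ι)) (Sop ∘ₗ (Qop ∘ₗ R3))
      (fun y y' => (BlockNorm.ofBlocks (unitTorusGeo L kk (cvM d L mv kk hL)) (liftBlk (fun y : Tor (cvM d L mv kk hL) => y) ι)).κ * BS * ((ScNorm d L mv kk hL ι).κ * τ * (((d : ℝ) + 1) * (B₃ * (1 + 1))) * cr) * cr *
        Real.exp (-((δ₀ - 4 * m) * (unitTorusGeo L kk (cvM d L mv kk hL)).dist y y'))) :=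
    B11SectG.hasMaj_comp_exp htri hd hrow hBS.le (by rw [hκF]; positivity) (by rw [hmdef]; linarith) (by rw [hmdef]; linarith) (by rw [hmdef]; linarith) hSi h1
  have h3' : HasMaj (BlockNorm.ofBlocks (unitTorusGeo L kk (cvM d L mv kk hL)) (liftBlk (fun b : ScX d L mv kk hL × Fin (d + 1) => blockOf (L ^ kk) (cvM d L mv kk hL) b.1) ι)) (ScNorm d L mv kk hL ι)
      (Rop ∘ₗ (Sop ∘ₗ (Qop ∘ₗ R3)))
      (fun y y' => (BlockNorm.ofBlocks (unitTorusGeo L kk (cvM d L mv kk hL)) (liftBlk (fun y : Tor (cvM d L mv kk hL) => y) ι)).κ * τ * ((BlockNorm.ofBlocks (unitTorusGeo L kk (cvM d L mv kk hL)) (liftBlk (fun y : Tor (cvM d L mv kk hL) => y) ι)).κ * BS * ((ScNorm d L mv kk hL ι).κ * τ * (((d : ℝ) + 1) * (B₃ * (1 + 1))) * cr) * cr) * cr *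
        Real.exp (-((δ₀ - 6 * m) * (unitTorusGeo L kk (cvM d L mv kk hL)).dist y y'))) :=
    B11SectG.hasMaj_comp_exp htri hd hrow hτ0 (by rw [hκF, hκC]; positivity) (by rw [hmdef]; linarith) (by rw [hmdef]; linarith) (by rw [hmdef]; linarith) hR h2'
  have h4' : HasMaj (BlockNorm.ofBlocks (unitTorusGeo L kk (cvM d L mv kk hL)) (liftBlk (fun b : ScX d L mv kk hL × Fin (d + 1) => blockOf (L ^ kk) (cvM d L mv kk hL) b.1) ι))
      (BlockNorm.ofBlocks (unitTorusGeo L kk (cvM d L mv kk hL)) (liftBlk (fun b : ScX d L mv kk hL × Fin (d + 1) => blockOf (L ^ kk) (cvM d L mv kk hL) b.1) ι))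
      (L2 ∘ₗ (Rop ∘ₗ (Sop ∘ₗ (Qop ∘ₗ R3))))
      (fun y y' => (ScNorm d L mv kk hL ι).κ * ((1 * (1 + 1 * cJ) + π) * B₂) * ((BlockNorm.ofBlocks (unitTorusGeo L kk (cvM d L mv kk hL)) (liftBlk (fun y : Tor (cvM d L mv kk hL) => y) ι)).κ * τ * ((BlockNorm.ofBlocks (unitTorusGeo L kk (cvM d L mv kk hL)) (liftBlk (fun y : Tor (cvM d L mv kk hL) => y) ι)).κ * BS * ((ScNorm d L mv kk hL ι).κ * τ * (((d : ℝ) + 1) * (B₃ * (1 + 1))) * cr) * cr) * cr) * cr *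
        Real.exp (-((δ₀ - 8 * m) * (unitTorusGeo L kk (cvM d L mv kk hL)).dist y y'))) :=
    B11SectG.hasMaj_comp_exp htri hd hrow (by positivity) (by rw [hκF, hκC]; positivity) (by rw [hmdef]; linarith) (by rw [hmdef]; linarith) (by rw [hmdef]; linarith) hL2 h3'
  -- `landauCov` IS this product
  have hcov : Matrix.mulVecLin (landauCov (cvM d L mv kk hL) (L ^ kk) (cvT e (fun μ x => (U μ x : Matrix mm mm ℂ))) (aK a₀ (L : ℝ) kk * (((L ^ kk : ℕ) : ℝ)) ^ (d + 1))) =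
      L2 ∘ₗ (Rop ∘ₗ (Sop ∘ₗ (Qop ∘ₗ R3))) := by
    rw [hL2def, hRop, hSop, hQop, hR3def]
    simp only [LinearMap.comp_smul, LinearMap.smul_comp, smul_smul, inv_mul_cancel₀ hnpos.ne', one_smul]
    rw [landauCov, cPi]
    simp only [Matrix.mul_assoc, Matrix.mulVecLin_mul, LinearMap.comp_assoc]
  rw [hcov]
  refine h4'.mono fun y y' => ?_
  rw [hκF, hκC]
  have hE := Real.exp_nonneg (-((δ₀ - 8 * m) * (unitTorusGeo L kk (cvM d L mv kk hL)).dist y y'))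
  nlinarith only [hE]

end Landau

end Summit.QuantumFields.YangMills.BalabanUVNodes.N15.Gluing

end
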